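import Summits.BirchSwinnertonDyer.BirchSwinnertonDyer.Theorems.KolyvaginRoadThreeSchneiderTamAtThreeStubTight
import Summits.BirchSwinnertonDyer.BirchSwinnertonDyer.Theorems.KolyvaginRoadThreeSchneiderTamAtThreeHeightLogNumeratorExactLimit
import Literature.NumberTheory.EllipticCurves.CanonicalPAdicHeightAdmissibleProofs
import HarnessLib

/-!
# Crux `SchneiderTamAtThree` (item 19154) — part 7e: the crux in the currency of NUMERATOR TOWERS
# (`SchneiderTamAtThree ⟺` «for every curve of the locus and every admissible point, `9^{−m} log₃ num x(3^mP)`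
# does not converge to `κ_E·log_E(P)²`», modulo GZK)

HONEST FRAMING (cell `bsd-stepL`, seat `bsd-stepL-tam3-p2` g3; `--supports stmt-BirchSwinnertonDyer-19154 --as helper`):
a THIN dictionary file (imports the route file through lane A's `…StubTight`); THEOREMS ONLY, 0 definitions, 0 named
facts, 0 sorry. Nothing here proves the crux, Schneider's conjecture or BSD; the crux-level statements are
CONDITIONAL on the registered rank-one stub (`stub_rankOneTamAtThree` = GZK, the named fact
`rank_eq_analyticRank_of_analyticRank_le_one`), exactly as `…StubTight` (p501328).

* §27 `forall_pairing_self_ne_zero_iff_admissible` — for any height datum: anisotropy on non-torsion points ⟺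
  anisotropy on ADMISSIBLE points (admissible multiples exist, `⟨mP,mP⟩ = m²⟨P,P⟩`).
* §28 `forall_admissible_pairing_ne_zero_iff_towers` — for THE canonical datum (`IsMultCanonical Dh q`):
  anisotropy on admissible points ⟺ no numerator tower converges to `κ_E·log_E(P)²` (part 7d §26).
* §29 `schneiderTamAtThree_iff_forall_tower`, `…_of_GZK` — **`SchneiderTamAtThree ⟺ ∀ W` on the locus, `∀` Tate
  parameter `q` and canonical `Dh`, `∀` admissible `P = (x, y)`: `¬ (9^{−m}·log₃ num x(3^m P) → κ_E·log_E(P)²)`**,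
  `κ_E = (C⁻²E₂(q) − b₂)/12`. READING: the crux's whole transcendence content is the statement that the `q`-free
  arithmetic limit `N(P) = lim 9^{−m} log₃ num x(3^mP)` (which EXISTS, part 7d) differs from `κ_E·log_E(P)²` — one
  `3`-adic constant per curve to avoid; per pair refuted-or-confirmed at a finite `m` (part 7c §21), class-wide OPEN
  (RULING 20 (A): blocked-on `Uniform.UI.O2.TateSigmaIrrationalAtThree`).

References: [SteinWuthrich2013] §4.1–4.2, Conj. 4.1; [Schneider1982PadicHeightI] §1; [MazurSteinTate2006] §1;
tree: `…StubTight` (p501328), parts 7b–7d.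
-/

noncomputable section

open scoped Classical
open Filter Topology IsUltrametricDist
open WeierstrassCurve Literature.NumberTheory.EllipticCurves
open Literature.NumberTheory.EllipticCurves.SteinWuthrich2013
open Literature.NumberTheory.EllipticCurves.TateCurve
open Literature.NumberTheory.EllipticCurves.Rank1Residual
open Summit.BirchSwinnertonDyer.Uniform.UI.O2
open Summit.BirchSwinnertonDyer.Rank1Residual.X11b.RegMult.SchneiderTamAtThreeStub

namespace Summit.BirchSwinnertonDyer.Rank1Residual.X11b.RegMult.HeightLogNumerator

/-! ### §27 Anisotropy on non-torsion points ⟺ on admissible points -/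

section Admissible

variable {W : WeierstrassCurve ℚ}

/-- **Anisotropy can be tested on admissible points.** For any `3`-adic height datum `Dh` on a globally minimal
`W`: `⟨P,P⟩ ≠ 0` for every non-torsion `P` iff `⟨P,P⟩ ≠ 0` for every ADMISSIBLE `P = (x, y)` (an admissible point
is non-torsion; conversely a non-torsion `P` has an admissible multiple `mP`, `m ≠ 0`, and `⟨mP,mP⟩ = m²⟨P,P⟩`).
[cite: MazurSteinTate2006, §1] [cite: SilvermanAEC2009, VII.6 Cor. 6.2] -/
theorem forall_pairing_self_ne_zero_iff_admissible [W.IsElliptic] [W.IsGloballyMinimal]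
    (Dh : PAdicHeightData W 3) :
    (∀ P : W.toAffine.Point, ¬ IsOfFinAddOrder P → Dh.pairing P P ≠ 0) ↔
      ∀ (x y : ℚ) (h : W.toAffine.Nonsingular x y), W.IsAdmissible 3 (.some x y h) →
        Dh.pairing (.some x y h) (.some x y h) ≠ 0 := by
  constructor
  · intro hA x y h hadm
    exact hA _ hadm.1
  · intro hA P hP
    obtain ⟨m, hm0, hadm⟩ := W.exists_admissible_nsmul_of_isIntegral 3 P hP
    rcases hpt : m • P with _ | ⟨x, y, h⟩
    · rw [hpt] at hadm; exact absurd hadm (W.not_isAdmissible_zero 3)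
    · rw [hpt] at hadm
      have hne := hA x y h hadm
      rw [← hpt, map_nsmul, map_nsmul, AddMonoidHom.nsmul_apply, smul_smul, nsmul_eq_mul] at hne
      intro h0
      rw [h0, mul_zero] at hne
      exact hne rfl

end Admissible

/-! ### §28 Anisotropy ⟺ no numerator tower converges to `κ_E·log_E(P)²` -/

section Towers

variable {W : WeierstrassCurve ℚ}

/-- **For THE canonical datum: anisotropy on admissible points ⟺ no numerator tower hits `κ_E·log_E(P)²`.**
For `W/ℚ` globally minimal with multiplicative reduction at `3`, `‖q‖₃ < 1`, `IsMultCanonical Dh q`: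
`(∀ admissible P, ⟨P,P⟩ ≠ 0) ⟺ (∀ admissible P = (x,y), ¬ (9^{−m} log₃ num x(3^m P) → κ_E·log_E(P)²))` (part 7d
§26 pointwise). [cite: SteinWuthrich2013, §4.1 eq. (4.1), §4.2] [cite: Schneider1982PadicHeightI, §1] -/
theorem forall_admissible_pairing_ne_zero_iff_towers [W.IsElliptic] [W.IsGloballyMinimal] (hW : Mult W 3)
    {q : ℚ_[3]} (hq : ‖q‖ < 1) {Dh : PAdicHeightData W 3} (hDh : IsMultCanonical Dh q) :
    (∀ (x y : ℚ) (h : W.toAffine.Nonsingular x y), W.IsAdmissible 3 (.some x y h) →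
        Dh.pairing (.some x y h) (.some x y h) ≠ 0) ↔
      ∀ (x y : ℚ) (h : W.toAffine.Nonsingular x y), W.IsAdmissible 3 (.some x y h) →
        ¬ Tendsto (fun m : ℕ ↦ ((9 : ℚ_[3]) ^ m)⁻¹ *
            padicLog 3 (((W.xCoord (3 ^ m • (.some x y h : W.toAffine.Point))).num : ℚ) : ℚ_[3]))
          atTop (𝓝 (((uniformisationScaleSq W 3 q)⁻¹ * (1 - 24 * tateS 1 q) - (W.baseChange ℚ_[3]).b₂) / 12 *
            (W.baseChange ℚ_[3]).padicFormalLog (-(x : ℚ_[3]) / y) ^ 2)) := by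
  refine forall_congr' fun x ↦ forall_congr' fun y ↦ forall_congr' fun h ↦ forall_congr' fun hadm ↦ ?_
  exact not_congr (pairing_self_eq_zero_iff_tendsto hW hq hDh hadm)

end Towers

/-! ### §29 The crux in the currency of numerator towers -/

section Crux

/-- **`SchneiderTamAtThree` ⟺ no numerator tower on the locus converges to `κ_E·log_E(P)²`** (modulo the
registered rank-one stub `hr`, = GZK): for every `W/ℚ` globally minimal of class X11b at `3` with a (ram) witness,
non-split multiplicative reduction at `3` and `3 ∣ ∏c`, every Tate parameter `q` (`q ≠ 0`, `‖q‖₃ < 1`,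
`tateJ q = j`) and canonical datum `Dh` (`IsMultCanonical Dh q`), and every admissible rational point `P = (x, y)`:
`¬ (9^{−m}·log₃ num x(3^m P) → κ_E·log_E(P)²)`, `κ_E = (C⁻²E₂(q) − b₂)/12`. Lane A's tightness
(`schneiderTamAtThree_iff_anisotropyTam`) + §27 + §28. [cite: SteinWuthrich2013, §4.2 and Conj. 4.1]
[cite: Schneider1982PadicHeightI, §1] -/
theorem schneiderTamAtThree_iff_forall_tower
    (hr : ∀ (W : WeierstrassCurve ℚ) [W.IsElliptic] [W.IsGloballyMinimal],
      Summit.BirchSwinnertonDyer.Rank1Residual.ClassX11b W 3 → 3 ∣ W.tamagawaProduct → W.mordellWeilRank = 1) :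
    Summit.BirchSwinnertonDyer.BirchSwinnertonDyer.Theses.KolyvaginRoadThree.SchneiderTamAtThree ↔
    ∀ (W : WeierstrassCurve ℚ) [W.IsElliptic] [W.IsGloballyMinimal],
      Summit.BirchSwinnertonDyer.Rank1Residual.ClassX11b W 3 →
      Literature.NumberTheory.EllipticCurves.Rank1Residual.Ram W 3 →
      ¬ W.HasSplitMultiplicativeReductionAtPrime 3 → 3 ∣ W.tamagawaProduct →
      ∀ (q : ℚ_[3]) (Dh : WeierstrassCurve.PAdicHeightData W 3), q ≠ 0 → ‖q‖ < 1 →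
        Literature.NumberTheory.EllipticCurves.tateJ q = (W.j : ℚ_[3]) →
        Literature.NumberTheory.EllipticCurves.SteinWuthrich2013.IsMultCanonical Dh q →
        ∀ (x y : ℚ) (h : W.toAffine.Nonsingular x y), W.IsAdmissible 3 (.some x y h) →
          ¬ Tendsto (fun m : ℕ ↦ ((9 : ℚ_[3]) ^ m)⁻¹ *
              padicLog 3 (((W.xCoord (3 ^ m • (.some x y h : W.toAffine.Point))).num : ℚ) : ℚ_[3]))
            atTop (𝓝 (((uniformisationScaleSq W 3 q)⁻¹ * (1 - 24 * tateS 1 q) - (W.baseChange ℚ_[3]).b₂) / 12 *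
              (W.baseChange ℚ_[3]).padicFormalLog (-(x : ℚ_[3]) / y) ^ 2)) := by
  rw [schneiderTamAtThree_iff_anisotropyTam hr]
  refine forall_congr' fun W ↦ forall_congr' fun _ ↦ forall_congr' fun _ ↦ forall_congr' fun hX ↦
    forall_congr' fun _ ↦ forall_congr' fun _ ↦ forall_congr' fun _ ↦ forall_congr' fun q ↦
    forall_congr' fun Dh ↦ forall_congr' fun _ ↦ forall_congr' fun hq ↦ forall_congr' fun _ ↦
    forall_congr' fun hDh ↦ ?_
  rw [forall_pairing_self_ne_zero_iff_admissible Dh]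
  exact forall_admissible_pairing_ne_zero_iff_towers hX.2.2.1 hq hDh

/-- **The same modulo the named fact GZK** (`rank_eq_analyticRank_of_analyticRank_le_one`, the registered
`stub_rankOneTamAtThree`). [cite: KolyvaginEulerSystems1990, Thm. A] [cite: SteinWuthrich2013, §4.2 and Conj. 4.1] -/
theorem schneiderTamAtThree_iff_forall_tower_of_GZK (hGZK : rank_eq_analyticRank_of_analyticRank_le_one) :
    Summit.BirchSwinnertonDyer.BirchSwinnertonDyer.Theses.KolyvaginRoadThree.SchneiderTamAtThree ↔
    ∀ (W : WeierstrassCurve ℚ) [W.IsElliptic] [W.IsGloballyMinimal],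
      Summit.BirchSwinnertonDyer.Rank1Residual.ClassX11b W 3 →
      Literature.NumberTheory.EllipticCurves.Rank1Residual.Ram W 3 →
      ¬ W.HasSplitMultiplicativeReductionAtPrime 3 → 3 ∣ W.tamagawaProduct →
      ∀ (q : ℚ_[3]) (Dh : WeierstrassCurve.PAdicHeightData W 3), q ≠ 0 → ‖q‖ < 1 →
        Literature.NumberTheory.EllipticCurves.tateJ q = (W.j : ℚ_[3]) →
        Literature.NumberTheory.EllipticCurves.SteinWuthrich2013.IsMultCanonical Dh q →
        ∀ (x y : ℚ) (h : W.toAffine.Nonsingular x y), W.IsAdmissible 3 (.some x y h) →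
          ¬ Tendsto (fun m : ℕ ↦ ((9 : ℚ_[3]) ^ m)⁻¹ *
              padicLog 3 (((W.xCoord (3 ^ m • (.some x y h : W.toAffine.Point))).num : ℚ) : ℚ_[3]))
            atTop (𝓝 (((uniformisationScaleSq W 3 q)⁻¹ * (1 - 24 * tateS 1 q) - (W.baseChange ℚ_[3]).b₂) / 12 *
              (W.baseChange ℚ_[3]).padicFormalLog (-(x : ℚ_[3]) / y) ^ 2)) :=
  schneiderTamAtThree_iff_forall_tower (rankOneTam_of_GZK hGZK)

end Crux

end Summit.BirchSwinnertonDyer.Rank1Residual.X11b.RegMult.HeightLogNumerator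

end
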